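import Mathlib.Analysis.InnerProductSpace.Basic
import Mathlib.Analysis.InnerProductSpace.Completion
import Mathlib.Analysis.InnerProductSpace.PiL2
import Mathlib.Analysis.InnerProductSpace.Projection.Basic
import Mathlib.Analysis.Convex.Cone.Extension
import Mathlib.Analysis.RCLike.Extend
import Mathlib.Algebra.MonoidAlgebra.Basic
import Mathlib.Algebra.FreeMonoid.Basic
import Mathlib.Analysis.Complex.Basic
import Mathlib.Topology.Algebra.LinearMapCompletion
import Mathlib.Analysis.Normed.Module.Completion
import Mathlib.LinearAlgebra.Isomorphisms
import Mathlib.Topology.Algebra.Module.FiniteDimension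
import Mathlib.Analysis.CStarAlgebra.Matrix
import Mathlib.Algebra.MvPolynomial.Funext
import Mathlib.Algebra.MvPolynomial.Nilpotent
import Mathlib.Algebra.Ring.GeomSum
import Mathlib.LinearAlgebra.Matrix.Determinant.Basic
import Mathlib.LinearAlgebra.Matrix.SchurComplement

/-!
# A free hereditary Positivstellensatz on the nc polydisc and the free lurking contraction

Noncommutative (nc) polynomials `ℂ⟨g_σ⟩` (Mathlib `MonoidAlgebra ℂ (FreeMonoid σ)`, `NC σ`),
hereditary kernels on pairs of words (`HKer σ`, `(w, u) ↦` coefficient of `w* u`), the hereditary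
square `hsqN f = f* f`, the shift `shiftK j k = g_j* k g_j`, and the **free polydisc quadratic
module** `coneN σ = 𝒞_free` generated by the `f* f` and the `f* f - g_j*(f* f)g_j` (`hsqN g - shiftK j
(hsqN g) = |g|² - |g_j g|²`). Proved here:

* `exists_smul_unitK_sub_mem_coneN`: `1` is an order unit of `𝒞_free` on Hermitian kernels;
  `exists_positive_functionalN`: a Hermitian kernel outside `𝒞_free` is separated from it by a
  positive functional with `L(1) = 1` (M. Riesz extension, Mathlib `riesz_extension`);
* the GNS space of such a functional (`PosFunctionalN.Space/Hilb`), on which the LEFT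
  multiplications `T_j : f ↦ g_j f` are contractions (`PosFunctionalN.T`, `norm_T_le`,
  `ncEval_T_vec : F(T)[f] = [F f]`) — they do not commute, which is what makes the free statement
  usable where the commutative one is not;
* **`hsqN_sub_smul_unitK_mem_coneN`** (the Positivstellensatz): if for every `ε > 0` there are nc
  polynomials `Q, E` with `Q P̂ + E = 1` and `‖Q(X)‖ ≤ C`, `‖E(X)‖ ≤ ε` at every tuple `X` of
  Hilbert-space contractions, then `P̂* P̂ - c²·1 ∈ 𝒞_free` whenever `0 < c`, `2Cc < 1` — the free
  analogue of [GrinshpanEtAl2016, Thm. 2.3] proved like [HeltonMccullough2004, Thm. 1.2];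
* `exists_sum_hsqN_of_mem_coneN`: a member of `𝒞_free` is a finite sum
  `Σ |s_i|² + Σ (|t_n|² - |g_{jj n} t_n|²)`; and the **free lurking contraction**
  `lurking_contractionN` ([GrinshpanEtAl2016, Thm. 3.4] at the level of WORD coefficients): if
  `Σ_i |v_i|² = Σ_k |x_k|²` as hereditary kernels, a contraction between the coefficient Euclidean
  spaces maps the coefficient vectors of `x` to those of `v` (`exists_contraction_of_gram_eq`).

This is the algebraic half of the proof of [GrinshpanEtAl2015, Thm. 3.1] given in
`ContractiveDeterminantalRepresentationsProofs.lean` (continued in `FreeDeterminantalRealization.lean`).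
Grouping namespace `GKVVW`.

## References

* [HeltonMccullough2004] J. W. Helton, S. McCullough, A Positivstellensatz for non-commutative
  polynomials, Trans. Amer. Math. Soc. 356 (2004) 3721–3737, Thm. 1.2 and its proof (cone separation
  and the GNS construction with left multiplication operators).
* [GrinshpanEtAl2015] A. Grinshpan, D. S. Kaliuzhnyi-Verbovetskyi, V. Vinnikov, H. J. Woerdeman,
  Contractive determinantal representations of stable polynomials on a matrix polyball, Math. Z. 283
  (2016) 25–37 = arXiv:1503.06161, Thm. 3.1 (p. 8) and its proof.
* [GrinshpanEtAl2016] the same, Matrix-valued Hermitian Positivstellensatz, lurking contractions, and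
  contractive determinantal representations of stable polynomials, Oper. Theory Adv. Appl. 255 (2016)
  123–136, Thm. 2.3 (Positivstellensatz), Thm. 3.4 (lurking contraction).
-/

noncomputable section

namespace Literature.Analysis.OperatorTheory
namespace GKVVW

open MvPolynomial
open scoped ComplexConjugate NNReal

variable {σ : Type}

section Lurking

open scoped InnerProductSpace

/-- **Equal Gram data are related by a contraction.** If two finite families of vectors in
Euclidean spaces have the same Gram matrix, a linear contraction maps the first onto the second
(an isometry on the span, extended by `0` on the orthogonal complement).
[cite: GrinshpanEtAl2016, Thm. 3.4 (proof, Claims 1 and 2)] -/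
theorem exists_contraction_of_gram_eq {ι κ A : Type} [Fintype ι] [Fintype κ] [Fintype A]
    [DecidableEq A] (v : A → EuclideanSpace ℂ ι) (x : A → EuclideanSpace ℂ κ)
    (hgram : ∀ a b, ⟪v a, v b⟫_ℂ = ⟪x a, x b⟫_ℂ) :
    ∃ S : EuclideanSpace ℂ ι →L[ℂ] EuclideanSpace ℂ κ, ‖S‖ ≤ 1 ∧ ∀ a, S (v a) = x a := by
  set Tv : (A → ℂ) →ₗ[ℂ] EuclideanSpace ℂ ι := Fintype.linearCombination ℂ v with hTv
  set Tx : (A → ℂ) →ₗ[ℂ] EuclideanSpace ℂ κ := Fintype.linearCombination ℂ x with hTx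
  -- the two synthesis maps have the same Gram form
  have hinner : ∀ c c' : A → ℂ, ⟪Tv c, Tv c'⟫_ℂ = ⟪Tx c, Tx c'⟫_ℂ := by
    intro c c'
    simp only [hTv, hTx, Fintype.linearCombination_apply, sum_inner, inner_sum, inner_smul_left,
      inner_smul_right, hgram]
  have hnormeq : ∀ c : A → ℂ, ‖Tx c‖ = ‖Tv c‖ := by
    intro c
    rw [@norm_eq_sqrt_re_inner ℂ, @norm_eq_sqrt_re_inner ℂ, hinner]
  have hker : LinearMap.ker Tv ≤ LinearMap.ker Tx := by
    intro c hc
    rw [LinearMap.mem_ker] at hc ⊢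
    rw [← norm_eq_zero, hnormeq, hc, norm_zero]
  -- the isometry `S₀ : range Tv → E κ`, `Tv c ↦ Tx c`
  set S₀ : LinearMap.range Tv →ₗ[ℂ] EuclideanSpace ℂ κ :=
    ((LinearMap.ker Tv).liftQ Tx hker).comp Tv.quotKerEquivRange.symm.toLinearMap with hS₀def
  have hS₀ : ∀ c : A → ℂ, S₀ ⟨Tv c, LinearMap.mem_range_self _ _⟩ = Tx c := by
    intro c
    simp only [S₀, LinearMap.comp_apply, LinearEquiv.coe_toLinearMap,
      LinearMap.quotKerEquivRange_symm_apply_image, Submodule.mkQ_apply, Submodule.liftQ_apply]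
  have hS₀norm : ∀ y : LinearMap.range Tv, ‖S₀ y‖ = ‖(y : EuclideanSpace ℂ ι)‖ := by
    rintro ⟨y, hy⟩
    obtain ⟨c, rfl⟩ := LinearMap.mem_range.mp hy
    rw [hS₀ c, hnormeq]
  -- extend by the orthogonal projection onto `range Tv`
  set S : EuclideanSpace ℂ ι →ₗ[ℂ] EuclideanSpace ℂ κ :=
    S₀.comp (LinearMap.range Tv).orthogonalProjectionOnto.toLinearMap with hSdef
  refine ⟨LinearMap.toContinuousLinearMap S, ?_, ?_⟩
  · refine ContinuousLinearMap.opNorm_le_bound _ zero_le_one fun u => ?_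
    rw [one_mul, LinearMap.coe_toContinuousLinearMap']
    show ‖S₀ ((LinearMap.range Tv).orthogonalProjectionOnto u)‖ ≤ ‖u‖
    rw [hS₀norm]
    exact Submodule.norm_orthogonalProjectionOnto_apply_le (LinearMap.range Tv) u
  · intro a
    rw [LinearMap.coe_toContinuousLinearMap']
    show S₀ ((LinearMap.range Tv).orthogonalProjectionOnto (v a)) = x a
    have hva : v a = Tv (Pi.single a 1) := by
      rw [hTv, Fintype.linearCombination_apply_single, one_smul]
    have hmem : v a ∈ LinearMap.range Tv := hva ▸ LinearMap.mem_range_self _ _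
    rw [Submodule.orthogonalProjectionOnto_mem_subspace_eq_self
      (⟨v a, hmem⟩ : LinearMap.range Tv)]
    have : (⟨v a, hmem⟩ : LinearMap.range Tv) =
        ⟨Tv (Pi.single a 1), LinearMap.mem_range_self _ _⟩ := by
      ext1; exact hva
    rw [this, hS₀, hTx, Fintype.linearCombination_apply_single, one_smul]

/-- Coordinates of a continuous linear map between Euclidean spaces:
`(S u)_k = Σ_i u_i · (S e_i)_k`. [folklore] -/
theorem clm_apply_eq_sum {ι κ : Type} [Fintype ι] [Fintype κ] [DecidableEq ι]
    (S : EuclideanSpace ℂ ι →L[ℂ] EuclideanSpace ℂ κ) (u : EuclideanSpace ℂ ι) (k : κ) :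
    S u k = ∑ i, u i * S (EuclideanSpace.single i 1) k := by
  have hu : u = ∑ i, u i • EuclideanSpace.single i (1 : ℂ) := by
    have := (EuclideanSpace.basisFun ι ℂ).sum_repr u
    simp only [EuclideanSpace.basisFun_repr, EuclideanSpace.basisFun_apply] at this
    exact this.symm
  conv_lhs => rw [hu]
  rw [map_sum]
  simp only [map_smul, WithLp.ofLp_sum, Finset.sum_apply, WithLp.ofLp_smul, Pi.smul_apply,
    smul_eq_mul]

end Lurking

variable {σ : Type}

/-! ### Free (noncommutative) polynomials and hereditary kernels on word pairs -/

/-- Noncommutative polynomials `ℂ⟨g_σ⟩` in free letters `g_j`: the monoid algebra of the free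
monoid of words. [folklore] -/
abbrev NC (σ : Type) := MonoidAlgebra ℂ (FreeMonoid σ)

/-- Hereditary kernels: finitely supported functions on pairs of words, `(w, u) ↦` the coefficient
of the hereditary word `w* u`. [folklore] -/
abbrev HKer (σ : Type) := (FreeMonoid σ × FreeMonoid σ) →₀ ℂ

/-- The letter `g_j` as an nc polynomial. [folklore] -/
def letter (j : σ) : NC σ := MonoidAlgebra.single (FreeMonoid.of j) 1

/-- Left multiplication by the letter `g_j`. [folklore] -/
def lmul (j : σ) (f : NC σ) : NC σ := letter j * f

/-- Coefficients of `g_j f`: `(g_j f)_{j u} = f_u`. [folklore] -/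
theorem coeff_lmul_cons (j : σ) (f : NC σ) (u : FreeMonoid σ) :
    (lmul j f).coeff (FreeMonoid.of j * u) = f.coeff u := by
  rw [lmul, letter, MonoidAlgebra.coeff_single_mul_eq_mul_coeff (m₂ := u), one_mul]
  intro m' _
  exact ⟨fun h => mul_left_cancel h, fun h => by rw [h]⟩

/-- Coefficients of `g_j f` vanish on words not starting with `g_j`. [folklore] -/
theorem coeff_lmul_of_ne (j : σ) (f : NC σ) (w : FreeMonoid σ) (hw : ∀ u, FreeMonoid.of j * u ≠ w) :
    (lmul j f).coeff w = 0 := by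
  rw [lmul, letter]
  exact MonoidAlgebra.coeff_single_mul_of_forall_mul_ne _ _ hw

/-- The sesquilinear kernel `f* g`: `(w, u) ↦ conj f_w · g_u`. [folklore] -/
def pairK (f g : NC σ) : HKer σ :=
  Finsupp.onFinset (f.coeff.support ×ˢ g.coeff.support) (fun p => conj (f.coeff p.1) * g.coeff p.2)
    (by
      intro p hp
      rw [Finset.mem_product, Finsupp.mem_support_iff, Finsupp.mem_support_iff]
      constructor
      · intro h; apply hp; rw [h, map_zero, zero_mul]
      · intro h; apply hp; rw [h, mul_zero])

/-- Entries of `pairK`. [folklore] -/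
@[simp] theorem pairK_apply (f g : NC σ) (w u : FreeMonoid σ) :
    pairK f g (w, u) = conj (f.coeff w) * g.coeff u := Finsupp.onFinset_apply

/-- The Hermitian square `|f|² = f* f` of an nc polynomial. [folklore] -/
def hsqN (f : NC σ) : HKer σ := pairK f f

/-- Entries of `hsqN`. [folklore] -/
@[simp] theorem hsqN_apply (f : NC σ) (w u : FreeMonoid σ) :
    hsqN f (w, u) = conj (f.coeff w) * f.coeff u := pairK_apply f f w u

/-- The adjoint kernel `k*(w, u) = conj k(u, w)`. [folklore] -/
def kstarK (k : HKer σ) : HKer σ :=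
  (Finsupp.mapDomain Prod.swap k).mapRange conj (map_zero _)

/-- Entries of the adjoint kernel. [folklore] -/
@[simp] theorem kstarK_apply (k : HKer σ) (w u : FreeMonoid σ) :
    kstarK k (w, u) = conj (k (u, w)) := by
  rw [kstarK, Finsupp.mapRange_apply, show ((w, u) : FreeMonoid σ × FreeMonoid σ) =
    Prod.swap (u, w) from rfl, Finsupp.mapDomain_apply Prod.swap_injective]

/-- The shift `k ↦ g_j* k g_j`: `(g_j w, g_j u) ↦ k(w, u)`. [folklore] -/
def shiftK (j : σ) (k : HKer σ) : HKer σ :=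
  Finsupp.mapDomain (fun p : FreeMonoid σ × FreeMonoid σ => (FreeMonoid.of j * p.1, FreeMonoid.of j * p.2)) k

/-- Prefixing both words by a letter is injective. [folklore] -/
theorem shiftK_injective_aux (j : σ) :
    Function.Injective (fun p : FreeMonoid σ × FreeMonoid σ =>
      (FreeMonoid.of j * p.1, FreeMonoid.of j * p.2)) := by
  intro p q h
  simp only [Prod.mk.injEq] at h
  exact Prod.ext (mul_left_cancel h.1) (mul_left_cancel h.2)

/-- Entries of the shift on prefixed pairs. [folklore] -/
@[simp] theorem shiftK_apply_cons (j : σ) (k : HKer σ) (w u : FreeMonoid σ) :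
    shiftK j k (FreeMonoid.of j * w, FreeMonoid.of j * u) = k (w, u) := by
  rw [shiftK]
  exact Finsupp.mapDomain_apply (shiftK_injective_aux j) k (w, u)

/-- The shift vanishes off prefixed pairs. [folklore] -/
theorem shiftK_apply_of_not (j : σ) (k : HKer σ) (p : FreeMonoid σ × FreeMonoid σ)
    (hp : ∀ w u, p ≠ (FreeMonoid.of j * w, FreeMonoid.of j * u)) : shiftK j k p = 0 := by
  rw [shiftK, Finsupp.mapDomain_notin_range]
  rintro ⟨q, hq⟩
  exact hp q.1 q.2 hq.symm

/-- The unit kernel `1 = δ_{(∅,∅)}`. [folklore] -/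
def unitK (σ : Type) : HKer σ := Finsupp.single (1, 1) 1

/-- `|g_j f|² = g_j* |f|² g_j`. [folklore] -/
theorem hsqN_lmul (j : σ) (f : NC σ) : hsqN (lmul j f) = shiftK j (hsqN f) := by
  ext ⟨w, u⟩
  rw [hsqN_apply]
  by_cases h : ∃ w' u', w = FreeMonoid.of j * w' ∧ u = FreeMonoid.of j * u'
  · obtain ⟨w', u', rfl, rfl⟩ := h
    rw [shiftK_apply_cons, coeff_lmul_cons, coeff_lmul_cons, hsqN_apply]
  · rw [shiftK_apply_of_not]
    · push Not at h
      by_cases hw : ∃ w', w = FreeMonoid.of j * w'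
      · obtain ⟨w', rfl⟩ := hw
        rw [coeff_lmul_of_ne j f u (fun u' hu => h w' u' rfl hu.symm), mul_zero]
      · push Not at hw
        rw [coeff_lmul_of_ne j f w (fun w' hw' => hw w' hw'.symm), map_zero, zero_mul]
    · intro w' u' hp
      rw [Prod.mk.injEq] at hp
      exact h ⟨w', u', hp.1, hp.2⟩

/-- `kstarK` is an involution. [folklore] -/
@[simp] theorem kstarK_kstarK (k : HKer σ) : kstarK (kstarK k) = k := by
  ext ⟨w, u⟩; simp

/-- `kstarK (f* g) = g* f`. [folklore] -/
theorem kstarK_pairK (f g : NC σ) : kstarK (pairK f g) = pairK g f := by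
  ext ⟨w, u⟩; simp [mul_comm]

/-- Hermitian squares are Hermitian. [folklore] -/
@[simp] theorem kstarK_hsqN (f : NC σ) : kstarK (hsqN f) = hsqN f := kstarK_pairK f f

/-- `kstarK` is additive. [folklore] -/
theorem kstarK_add (k l : HKer σ) : kstarK (k + l) = kstarK k + kstarK l := by
  ext ⟨w, u⟩; simp

/-- `kstarK` is conjugate-linear. [folklore] -/
theorem kstarK_smul (a : ℂ) (k : HKer σ) : kstarK (a • k) = conj a • kstarK k := by
  ext ⟨w, u⟩; simp

/-- `kstarK` is real-linear. [folklore] -/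
theorem kstarK_real_smul (r : ℝ) (k : HKer σ) : kstarK (r • k) = r • kstarK k := by
  ext ⟨w, u⟩; simp [Complex.real_smul]

/-- `kstarK 0 = 0`. [folklore] -/
@[simp] theorem kstarK_zero : kstarK (0 : HKer σ) = 0 := by ext ⟨w, u⟩; simp

/-- `kstarK` commutes with negation. [folklore] -/
@[simp] theorem kstarK_neg (k : HKer σ) : kstarK (-k) = -kstarK k := by ext ⟨w, u⟩; simp

/-- `kstarK` commutes with subtraction. [folklore] -/
theorem kstarK_sub (k l : HKer σ) : kstarK (k - l) = kstarK k - kstarK l := by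
  ext ⟨w, u⟩; simp

/-- `kstarK` commutes with the shifts. [folklore] -/
theorem kstarK_shiftK (j : σ) (k : HKer σ) : kstarK (shiftK j k) = shiftK j (kstarK k) := by
  ext ⟨w, u⟩
  rw [kstarK_apply]
  by_cases h : ∃ w' u', w = FreeMonoid.of j * w' ∧ u = FreeMonoid.of j * u'
  · obtain ⟨w', u', rfl, rfl⟩ := h
    rw [shiftK_apply_cons, shiftK_apply_cons, kstarK_apply]
  · rw [shiftK_apply_of_not, shiftK_apply_of_not, map_zero]
    · intro w' u' hp; rw [Prod.mk.injEq] at hp; exact h ⟨w', u', hp.1, hp.2⟩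
    · intro w' u' hp; rw [Prod.mk.injEq] at hp; exact h ⟨u', w', hp.2, hp.1⟩

/-- The shifts are additive. [folklore] -/
theorem shiftK_add (j : σ) (k l : HKer σ) : shiftK j (k + l) = shiftK j k + shiftK j l :=
  Finsupp.mapDomain_add

/-- The shifts are linear. [folklore] -/
theorem shiftK_smul (j : σ) (a : ℂ) (k : HKer σ) : shiftK j (a • k) = a • shiftK j k :=
  Finsupp.mapDomain_smul a k

/-- The unit kernel is Hermitian. [folklore] -/
@[simp] theorem kstarK_unitK : kstarK (unitK σ) = unitK σ := by
  classical
  ext ⟨w, u⟩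
  rw [kstarK_apply, unitK, Finsupp.single_apply, Finsupp.single_apply]
  by_cases h : ((1 : FreeMonoid σ), (1 : FreeMonoid σ)) = (u, w)
  · have h' : ((1 : FreeMonoid σ), (1 : FreeMonoid σ)) = (w, u) := by
      rw [Prod.mk.injEq] at h ⊢; exact ⟨h.2, h.1⟩
    rw [if_pos h, if_pos h', map_one]
  · have h' : ¬((1 : FreeMonoid σ), (1 : FreeMonoid σ)) = (w, u) := by
      intro h'; apply h; rw [Prod.mk.injEq] at h' ⊢; exact ⟨h'.2, h'.1⟩
    rw [if_neg h, if_neg h', map_zero]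

/-- `|a f|² = |a|² |f|²`. [folklore] -/
theorem hsqN_smul (a : ℂ) (f : NC σ) : hsqN (a • f) = ((Complex.normSq a : ℝ) : ℂ) • hsqN f := by
  ext ⟨w, u⟩
  simp only [hsqN_apply, MonoidAlgebra.coeff_smul_apply, smul_eq_mul, map_mul, Finsupp.smul_apply]
  rw [← Complex.mul_conj]; ring

/-- `pairK` is additive in each argument. [folklore] -/
theorem pairK_add_left (f₁ f₂ g : NC σ) : pairK (f₁ + f₂) g = pairK f₁ g + pairK f₂ g := by
  ext ⟨w, u⟩; simp [add_mul]

/-- `pairK` is additive on the right. [folklore] -/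
theorem pairK_add_right (f g₁ g₂ : NC σ) : pairK f (g₁ + g₂) = pairK f g₁ + pairK f g₂ := by
  ext ⟨w, u⟩; simp [mul_add]

/-- `pairK` is conjugate-linear on the left. [folklore] -/
theorem pairK_smul_left (a : ℂ) (f g : NC σ) : pairK (a • f) g = conj a • pairK f g := by
  ext ⟨w, u⟩; simp [mul_assoc]

/-- `pairK` is linear on the right. [folklore] -/
theorem pairK_smul_right (a : ℂ) (f g : NC σ) : pairK f (a • g) = a • pairK f g := by
  ext ⟨w, u⟩; simp; ring

/-- `pairK` and negation (left). [folklore] -/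
theorem pairK_neg_left (f g : NC σ) : pairK (-f) g = -pairK f g := by
  ext ⟨w, u⟩; simp

/-- `pairK` and negation (right). [folklore] -/
theorem pairK_neg_right (f g : NC σ) : pairK f (-g) = -pairK f g := by
  ext ⟨w, u⟩; simp

/-- The parallelogram law. [folklore] -/
theorem hsqN_add_add_hsqN_sub (f g : NC σ) :
    hsqN (f + g) + hsqN (f - g) = (2 : ℂ) • hsqN f + (2 : ℂ) • hsqN g := by
  ext ⟨w, u⟩
  simp only [hsqN_apply, Finsupp.add_apply, Finsupp.smul_apply, MonoidAlgebra.coeff_add,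
    MonoidAlgebra.coeff_sub, Finsupp.add_apply, Finsupp.sub_apply, map_add, map_sub, smul_eq_mul]
  ring

/-- The basis kernel `e_{(w,u)}` is `δ_w* δ_u`. [folklore] -/
theorem single_eq_pairK (w u : FreeMonoid σ) (a : ℂ) :
    (Finsupp.single (w, u) a : HKer σ) =
      a • pairK (MonoidAlgebra.single w (1 : ℂ)) (MonoidAlgebra.single u 1) := by
  classical
  ext ⟨w', u'⟩
  simp only [Finsupp.single_apply, Finsupp.smul_apply, pairK_apply, MonoidAlgebra.coeff_single,
    Prod.mk.injEq, smul_eq_mul]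
  by_cases hw : w = w' <;> by_cases hu : u = u' <;> simp [hw, hu]

/-- Polarisation of a mixed term: `a f*g + conj a · g*f = |f + a g|² - |f|² - |a|²|g|²`. [folklore] -/
theorem polarisationN (a : ℂ) (f g : NC σ) :
    a • pairK f g + conj a • pairK g f =
      hsqN (f + a • g) - hsqN f - ((Complex.normSq a : ℝ) : ℂ) • hsqN g := by
  ext ⟨w, u⟩
  simp only [Finsupp.add_apply, Finsupp.sub_apply, Finsupp.smul_apply, pairK_apply, hsqN_apply,
    MonoidAlgebra.coeff_add, MonoidAlgebra.coeff_smul_apply, Finsupp.add_apply, smul_eq_mul,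
    map_add, map_mul]
  rw [← Complex.mul_conj]; ring

/-- Real scalars act as complex scalars on kernels. [folklore] -/
theorem ofReal_smulK (c : ℝ) (k : HKer σ) : ((c : ℂ) • k) = c • k := by
  ext p; simp [Complex.real_smul]

/-- `hsqN` of the empty word is the unit kernel. [folklore] -/
theorem hsqN_single_one : hsqN (MonoidAlgebra.single (1 : FreeMonoid σ) (1 : ℂ)) = unitK σ := by
  classical
  ext ⟨w, u⟩
  rw [hsqN_apply, unitK, Finsupp.single_apply, MonoidAlgebra.coeff_single, Finsupp.single_apply,
    Finsupp.single_apply]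
  by_cases hw : (1 : FreeMonoid σ) = w <;> by_cases hu : (1 : FreeMonoid σ) = u <;>
    simp [hw, hu, Prod.ext_iff]

/-- Words as left products of letters: `δ_{g_j w} = g_j δ_w`. [folklore] -/
theorem single_of_mul (j : σ) (w : FreeMonoid σ) :
    (MonoidAlgebra.single (FreeMonoid.of j * w) (1 : ℂ) : NC σ) = lmul j (MonoidAlgebra.single w 1) := by
  rw [lmul, letter, MonoidAlgebra.single_mul_single, one_mul]

/-! ### The free polydisc quadratic module `𝒞_free` -/

/-- Generators: Hermitian squares `|g|²` and `|g|² - |g_j g|²` (`= g*(1 - g_j*g_j)g`). [folklore] -/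
def coneGenN (σ : Type) : Set (HKer σ) :=
  {k | ∃ g : NC σ, k = hsqN g} ∪ {k | ∃ (j : σ) (g : NC σ), k = hsqN g - shiftK j (hsqN g)}

/-- **The cone `𝒞_free`** of hereditary sums of squares `Σᵢ ŝᵢ*ŝᵢ + Σ_j Σᵢ t̂ᵢ*(1 - g_j*g_j)t̂ᵢ` with
analytic nc polynomials `ŝ, t̂`, as a pointed cone of hereditary kernels (the quadratic module of
the nc polydisc, hereditary form). [folklore] -/
def coneN (σ : Type) : PointedCone ℝ (HKer σ) := Submodule.span _ (coneGenN σ)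

/-- Hermitian squares lie in `𝒞_free`. [folklore] -/
theorem hsqN_mem_coneN (g : NC σ) : hsqN g ∈ coneN σ :=
  Submodule.subset_span (Or.inl ⟨g, rfl⟩)

/-- Weighted Hermitian squares lie in `𝒞_free`. [folklore] -/
theorem hsqN_sub_shiftK_mem_coneN (j : σ) (g : NC σ) : hsqN g - shiftK j (hsqN g) ∈ coneN σ :=
  Submodule.subset_span (Or.inr ⟨j, g, rfl⟩)

/-- `𝒞_free` is closed under multiplication by nonnegative reals. [folklore] -/
theorem smul_mem_coneN {c : ℝ} (hc : 0 ≤ c) {k : HKer σ} (hk : k ∈ coneN σ) : c • k ∈ coneN σ :=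
  Submodule.smul_mem (coneN σ) ⟨c, hc⟩ hk

/-- `𝒞_free` is closed under nonnegative real multiples written as complex scalars. [folklore] -/
theorem ofReal_smul_mem_coneN {c : ℝ} (hc : 0 ≤ c) {k : HKer σ} (hk : k ∈ coneN σ) :
    (c : ℂ) • k ∈ coneN σ := by
  rw [ofReal_smulK]; exact smul_mem_coneN hc hk

/-- Nonnegative multiples of the unit lie in `𝒞_free`. [folklore] -/
theorem smul_unitK_mem_coneN {r : ℝ} (hr : 0 ≤ r) : r • unitK σ ∈ coneN σ := by
  rw [← hsqN_single_one]; exact smul_mem_coneN hr (hsqN_mem_coneN _)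

/-- Elements of `𝒞_free` are Hermitian. [folklore] -/
theorem kstarK_eq_self_of_mem_coneN {k : HKer σ} (hk : k ∈ coneN σ) : kstarK k = k := by
  induction hk using Submodule.span_induction with
  | mem x hx =>
    rcases hx with ⟨g, rfl⟩ | ⟨j, g, rfl⟩
    · exact kstarK_hsqN g
    · rw [kstarK_sub, kstarK_shiftK, kstarK_hsqN]
  | zero => exact kstarK_zero
  | add x y _ _ hx hy => rw [kstarK_add, hx, hy]
  | smul c x _ hx =>
    show kstarK ((c : ℝ) • x) = (c : ℝ) • x
    rw [kstarK_real_smul, hx]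

/-- The positive functional `k ↦ re k(∅, ∅)` is nonnegative on `𝒞_free`. [folklore] -/
theorem re_apply_one_nonneg_of_mem_coneN {k : HKer σ} (hk : k ∈ coneN σ) :
    0 ≤ (k (1, 1)).re := by
  have hhsq : ∀ g : NC σ, 0 ≤ (hsqN g (1, 1)).re := fun g => by
    rw [hsqN_apply, mul_comm, Complex.mul_conj, Complex.ofReal_re]; exact Complex.normSq_nonneg _
  have hshift : ∀ (j : σ) (g : NC σ), shiftK j (hsqN g) (1, 1) = 0 := by
    intro j g
    refine shiftK_apply_of_not j _ _ fun w u h => ?_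
    rw [Prod.mk.injEq] at h
    have := congrArg FreeMonoid.length h.1
    rw [FreeMonoid.length_one, FreeMonoid.length_mul, FreeMonoid.length_of] at this
    omega
  induction hk using Submodule.span_induction with
  | mem x hx =>
    rcases hx with ⟨g, rfl⟩ | ⟨j, g, rfl⟩
    · exact hhsq g
    · rw [Finsupp.sub_apply, hshift, sub_zero]; exact hhsq g
  | zero => simp
  | add x y _ _ hx hy => rw [Finsupp.add_apply, Complex.add_re]; exact add_nonneg hx hy
  | smul c x _ hx =>
    show 0 ≤ (((c : ℝ) • x) (1, 1)).re
    rw [Finsupp.smul_apply, Complex.smul_re]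
    exact mul_nonneg c.2 hx

/-- `𝒞_free` contains no negative multiples of the unit. [folklore] -/
theorem nonneg_of_smul_unitK_mem_coneN {r : ℝ} (hr : r • unitK σ ∈ coneN σ) : 0 ≤ r := by
  have := re_apply_one_nonneg_of_mem_coneN hr
  simpa [unitK] using this

/-! ### `1` is an order unit of `𝒞_free` -/

/-- Every nc polynomial is bounded modulo `𝒞_free`: `a·1 - |f|² ∈ 𝒞_free` for some `a ≥ 0`
(closure of this property under left multiplication by letters, sums and scalars). [folklore] -/
theorem exists_smul_unitK_sub_hsqN_mem_coneN (f : NC σ) :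
    ∃ a : ℝ, 0 ≤ a ∧ a • unitK σ - hsqN f ∈ coneN σ := by
  induction f using MonoidAlgebra.induction_on with
  | hM w =>
    rw [MonoidAlgebra.of_apply]
    induction w using FreeMonoid.inductionOn' with
    | one =>
      refine ⟨1, zero_le_one, ?_⟩
      rw [hsqN_single_one, one_smul, sub_self]
      exact Submodule.zero_mem _
    | mul_of x xs ih =>
      obtain ⟨a, ha, hmem⟩ := ih
      refine ⟨a, ha, ?_⟩
      have : a • unitK σ - hsqN (MonoidAlgebra.single (FreeMonoid.of x * xs) (1 : ℂ)) =
          (a • unitK σ - hsqN (MonoidAlgebra.single xs 1)) +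
            (hsqN (MonoidAlgebra.single xs 1) - shiftK x (hsqN (MonoidAlgebra.single xs 1))) := by
        rw [single_of_mul, hsqN_lmul]; abel
      rw [this]
      exact Submodule.add_mem _ hmem (hsqN_sub_shiftK_mem_coneN _ _)
  | hadd p q hp hq =>
    obtain ⟨a, ha, hpa⟩ := hp
    obtain ⟨b, hb, hqb⟩ := hq
    refine ⟨2 * a + 2 * b, by positivity, ?_⟩
    have key : (2 * a + 2 * b) • unitK σ - hsqN (p + q) =
        (2 : ℝ) • (a • unitK σ - hsqN p) + (2 : ℝ) • (b • unitK σ - hsqN q) + hsqN (p - q) := by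
      have h2 := hsqN_add_add_hsqN_sub p q
      have e2 : ((2 : ℂ) • hsqN p) = (2 : ℝ) • hsqN p := by
        rw [← ofReal_smulK]; norm_num
      have e2' : ((2 : ℂ) • hsqN q) = (2 : ℝ) • hsqN q := by
        rw [← ofReal_smulK]; norm_num
      rw [e2, e2'] at h2
      rw [smul_sub, smul_sub, smul_smul, smul_smul, add_smul, mul_smul, mul_smul]
      have : hsqN (p + q) = (2 : ℝ) • hsqN p + (2 : ℝ) • hsqN q - hsqN (p - q) :=
        eq_sub_of_add_eq h2
      rw [this]
      abel
    rw [key]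
    exact Submodule.add_mem _ (Submodule.add_mem _ (smul_mem_coneN zero_le_two hpa)
      (smul_mem_coneN zero_le_two hqb)) (hsqN_mem_coneN _)
  | hsmul r p hp =>
    obtain ⟨a, ha, hpa⟩ := hp
    refine ⟨Complex.normSq r * a, mul_nonneg (Complex.normSq_nonneg _) ha, ?_⟩
    have key : (Complex.normSq r * a) • unitK σ - hsqN (r • p) =
        (Complex.normSq r) • (a • unitK σ - hsqN p) := by
      rw [hsqN_smul, ofReal_smulK, smul_sub, smul_smul]
    rw [key]
    exact smul_mem_coneN (Complex.normSq_nonneg _) hpa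

/-- The adjoint of a basis kernel. [folklore] -/
theorem kstarK_single (p : FreeMonoid σ × FreeMonoid σ) (a : ℂ) :
    kstarK (Finsupp.single p a) = Finsupp.single p.swap (conj a) := by
  classical
  ext ⟨w, u⟩
  rw [kstarK_apply, Finsupp.single_apply, Finsupp.single_apply]
  by_cases h : p = (u, w)
  · rw [if_pos h, if_pos (by rw [h]; rfl)]
  · rw [if_neg h, if_neg, map_zero]
    intro h'; apply h
    have := congrArg Prod.swap h'
    simpa using this

/-- `kstarK` of a finite sum. [folklore] -/
theorem kstarK_sum {ι : Type*} (s : Finset ι) (f : ι → HKer σ) :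
    kstarK (∑ i ∈ s, f i) = ∑ i ∈ s, kstarK (f i) := by
  classical
  induction s using Finset.induction_on with
  | empty => rw [Finset.sum_empty, Finset.sum_empty, kstarK_zero]
  | insert a s ha ih => rw [Finset.sum_insert ha, Finset.sum_insert ha, kstarK_add, ih]

/-- **`1` is an order unit of `𝒞_free`**: for every Hermitian kernel `k` there is `N ≥ 0` with
`N·1 - k ∈ 𝒞_free`. [folklore] -/
theorem exists_smul_unitK_sub_mem_coneN {k : HKer σ} (hk : kstarK k = k) :
    ∃ N : ℝ, 0 ≤ N ∧ N • unitK σ - k ∈ coneN σ := by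
  classical
  let δ : FreeMonoid σ → NC σ := fun w => MonoidAlgebra.single w 1
  let u : (FreeMonoid σ × FreeMonoid σ) → NC σ := fun p => δ p.1 + (k p) • δ p.2
  -- `2k = Σ_p [ |u_p|² - |δ_{p.1}|² - |k_p|² |δ_{p.2}|² ]`
  have hsum : (2 : ℝ) • k = ∑ p ∈ k.support,
      (hsqN (u p) - hsqN (δ p.1) - ((Complex.normSq (k p) : ℝ) : ℂ) • hsqN (δ p.2)) := by
    have h2 : (2 : ℝ) • k = k + kstarK k := by rw [hk, two_smul]
    rw [h2]
    conv_lhs => rw [← k.sum_single]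
    rw [Finsupp.sum, kstarK_sum, ← Finset.sum_add_distrib]
    refine Finset.sum_congr rfl fun p _ => ?_
    show _ = hsqN (δ p.1 + (k p) • δ p.2) - hsqN (δ p.1) -
      ((Complex.normSq (k p) : ℝ) : ℂ) • hsqN (δ p.2)
    rw [← polarisationN, kstarK_single, single_eq_pairK, single_eq_pairK]
    rfl
  choose N hN0 hN using fun p => exists_smul_unitK_sub_hsqN_mem_coneN (u p)
  refine ⟨(1 / 2) * ∑ p ∈ k.support, N p,
    mul_nonneg (by norm_num) (Finset.sum_nonneg fun p _ => hN0 p), ?_⟩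
  have hterms : ∑ p ∈ k.support,
      ((N p • unitK σ - hsqN (u p)) + hsqN (δ p.1) +
        ((Complex.normSq (k p) : ℝ) : ℂ) • hsqN (δ p.2)) =
      (∑ p ∈ k.support, N p) • unitK σ - (2 : ℝ) • k := by
    rw [hsum, Finset.sum_smul, ← Finset.sum_sub_distrib]
    refine Finset.sum_congr rfl fun p _ => ?_
    abel
  have key : ((1 / 2 : ℝ) * ∑ p ∈ k.support, N p) • unitK σ - k =
      (1 / 2 : ℝ) • ∑ p ∈ k.support,
        ((N p • unitK σ - hsqN (u p)) + hsqN (δ p.1) +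
          ((Complex.normSq (k p) : ℝ) : ℂ) • hsqN (δ p.2)) := by
    rw [hterms, smul_sub, smul_smul, smul_smul, show (1 / 2 : ℝ) * 2 = 1 by norm_num, one_smul]
  rw [key]
  refine smul_mem_coneN (by norm_num) (Submodule.sum_mem _ fun p _ => ?_)
  exact Submodule.add_mem _ (Submodule.add_mem _ (hN p) (hsqN_mem_coneN _))
    (ofReal_smul_mem_coneN (Complex.normSq_nonneg _) (hsqN_mem_coneN _))

/-! ### Separation (M. Riesz extension) -/

/-- The real subspace of anti-Hermitian kernels `k* = -k`. [folklore] -/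
def antiHermN (σ : Type) : Submodule ℝ (HKer σ) where
  carrier := {k | kstarK k = -k}
  add_mem' := by
    intro a b ha hb
    simp only [Set.mem_setOf_eq] at *
    rw [kstarK_add, ha, hb, neg_add]
  zero_mem' := by simp
  smul_mem' := by
    intro c k hk
    simp only [Set.mem_setOf_eq] at *
    rw [kstarK_real_smul, hk, smul_neg]

/-- Membership in `antiHermN`. [folklore] -/
theorem mem_antiHermN {k : HKer σ} : k ∈ antiHermN σ ↔ kstarK k = -k := Iff.rfl

/-- The anti-Hermitian part `(y - y*)/2`. [folklore] -/
theorem sub_kstarK_mem_antiHermN (y : HKer σ) : (1 / 2 : ℝ) • (y - kstarK y) ∈ antiHermN σ := by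
  rw [mem_antiHermN, kstarK_real_smul, kstarK_sub, kstarK_kstarK, ← smul_neg, neg_sub]

/-- The Hermitian part `(y + y*)/2` is Hermitian. [folklore] -/
theorem kstarK_add_kstarK (y : HKer σ) :
    kstarK ((1 / 2 : ℝ) • (y + kstarK y)) = (1 / 2 : ℝ) • (y + kstarK y) := by
  rw [kstarK_real_smul, kstarK_add, kstarK_kstarK, add_comm]

/-- **Separation in the free setting.** If a Hermitian kernel `h` is not in `𝒞_free`, there is a
real-linear functional `L ≥ 0` on `𝒞_free` with `L(1) = 1`, `L(h) ≤ 0`, vanishing on anti-Hermitian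
kernels. [folklore] -/
theorem exists_positive_functionalN {h : HKer σ} (hherm : kstarK h = h) (hnot : h ∉ coneN σ) :
    ∃ L : HKer σ →ₗ[ℝ] ℝ, (∀ k ∈ coneN σ, 0 ≤ L k) ∧ L (unitK σ) = 1 ∧ L h ≤ 0 ∧
      ∀ k, kstarK k = -k → L k = 0 := by
  classical
  set S : PointedCone ℝ (HKer σ) :=
    coneN σ ⊔ Submodule.span _ {-h} ⊔ PointedCone.ofSubmodule (antiHermN σ) with hS
  have hcone_le : coneN σ ≤ S := le_sup_left.trans le_sup_left
  have hnegh : -h ∈ S :=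
    Submodule.mem_sup_left (Submodule.mem_sup_right (Submodule.subset_span rfl))
  have hanti : ∀ t, kstarK t = -t → t ∈ S := fun t ht =>
    Submodule.mem_sup_right (show t ∈ antiHermN σ from ht)
  have h10 : (unitK σ) ≠ 0 := by
    intro h0
    have := congrArg (fun k : HKer σ => k (1, 1)) h0
    simp [unitK] at this
  let f : HKer σ →ₗ.[ℝ] ℝ := LinearPMap.mkSpanSingleton (unitK σ) (1 : ℝ) h10
  have hfval : ∀ (a : ℝ) (hx : (a • unitK σ) ∈ f.domain), f ⟨a • unitK σ, hx⟩ = a := by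
    intro a hx
    show LinearPMap.mkSpanSingleton' (unitK σ) (1 : ℝ) _ ⟨a • unitK σ, hx⟩ = a
    rw [LinearPMap.mkSpanSingleton'_apply]
    simp
  have hnonneg : ∀ x : f.domain, (x : HKer σ) ∈ S → 0 ≤ f x := by
    rintro ⟨x, hx⟩ hxS
    obtain ⟨a, rfl⟩ := Submodule.mem_span_singleton.mp hx
    rw [hfval a hx]
    obtain ⟨y, hy, t, ht, hyt⟩ := Submodule.mem_sup.mp hxS
    obtain ⟨c₀, hc₀, s, hs, rfl⟩ := Submodule.mem_sup.mp hy
    obtain ⟨τ, rfl⟩ := Submodule.mem_span_singleton.mp hs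
    have ht' : kstarK t = -t := ht
    have hsym : ((2 * a : ℝ) • unitK σ) = (2 : ℝ) • c₀ - (2 * (τ : ℝ)) • h := by
      have e1 : c₀ + τ • (-h) + t = a • unitK σ := hyt
      have e2 := congrArg kstarK e1
      rw [← Nonneg.coe_smul] at e1 e2
      rw [kstarK_add, kstarK_add, kstarK_eq_self_of_mem_coneN hc₀, ht', kstarK_real_smul, kstarK_neg,
        hherm, kstarK_real_smul, kstarK_unitK] at e2
      have e3 := congrArg₂ (· + ·) e1 e2
      rw [mul_smul, mul_smul, two_smul, two_smul, two_smul, ← e3, smul_neg]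
      abel
    by_contra! hneg
    rcases eq_or_lt_of_le τ.2 with hτ | hτ
    · have hmem : ((2 * a : ℝ) • unitK σ) ∈ coneN σ := by
        rw [hsym, ← hτ]; simpa using smul_mem_coneN zero_le_two hc₀
      have := nonneg_of_smul_unitK_mem_coneN hmem
      linarith
    · apply hnot
      have hh : h = (1 / (2 * (τ : ℝ))) • ((2 : ℝ) • c₀ + (-(2 * a)) • unitK σ) := by
        have hτ0 : (2 * (τ : ℝ)) ≠ 0 := by positivity
        rw [neg_smul, hsym]
        rw [show (2 : ℝ) • c₀ + -((2 : ℝ) • c₀ - (2 * (τ : ℝ)) • h) = (2 * (τ : ℝ)) • h by abel,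
          smul_smul, one_div_mul_cancel hτ0, one_smul]
      rw [hh]
      refine smul_mem_coneN (by positivity) (Submodule.add_mem _ (smul_mem_coneN zero_le_two hc₀)
        (smul_unitK_mem_coneN (by linarith)))
  have hdense : ∀ y : HKer σ, ∃ x : f.domain, (x : HKer σ) + y ∈ S := by
    intro y
    obtain ⟨N, -, hN⟩ := exists_smul_unitK_sub_mem_coneN (k := -((1 / 2 : ℝ) • (y + kstarK y)))
      (by rw [kstarK_neg, kstarK_add_kstarK])
    refine ⟨⟨N • unitK σ, Submodule.mem_span_singleton.mpr ⟨N, rfl⟩⟩, ?_⟩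
    have hdecomp : (N • unitK σ : HKer σ) + y =
        (N • unitK σ - -((1 / 2 : ℝ) • (y + kstarK y))) + (1 / 2 : ℝ) • (y - kstarK y) := by
      rw [sub_neg_eq_add, smul_add, smul_sub, add_assoc]
      congr 1
      rw [show (1 / 2 : ℝ) • y + (1 / 2 : ℝ) • kstarK y + ((1 / 2 : ℝ) • y - (1 / 2 : ℝ) • kstarK y) =
        (1 / 2 : ℝ) • y + (1 / 2 : ℝ) • y by abel, ← add_smul]
      norm_num
    simp only
    rw [hdecomp]
    exact Submodule.add_mem _ (hcone_le hN) (hanti _ (sub_kstarK_mem_antiHermN y))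
  obtain ⟨g, hgf, hgS⟩ := riesz_extension S f hnonneg hdense
  refine ⟨g, fun k hk => hgS k (hcone_le hk), ?_, ?_, ?_⟩
  · have h1 : (unitK σ) ∈ f.domain := Submodule.mem_span_singleton_self _
    have := hgf ⟨unitK σ, h1⟩
    rw [this]
    have h1' : ((1 : ℝ) • unitK σ) ∈ f.domain := by rwa [one_smul]
    have := hfval 1 h1'
    simp only [one_smul] at this
    exact this
  · have := hgS _ hnegh
    rw [map_neg] at this
    linarith
  · intro k hk
    have h1 := hgS _ (hanti k hk)
    have h2 := hgS _ (hanti (-k) (by rw [kstarK_neg, hk]))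
    rw [map_neg] at h2
    linarith

/-! ### Evaluation of nc polynomials at operator tuples -/

/-- Evaluation `F(X) = Σ_w F_w X_{w₁}⋯X_{w_k}` of an nc polynomial at a tuple `X` in an algebra
(Mathlib `MonoidAlgebra.lift` of `FreeMonoid.lift`). [folklore] -/
def ncEval {A : Type*} [Ring A] [Algebra ℂ A] (X : σ → A) : NC σ →ₐ[ℂ] A :=
  MonoidAlgebra.lift ℂ A (FreeMonoid σ) (FreeMonoid.lift X)

/-- `ncEval` on a word. [folklore] -/
theorem ncEval_single {A : Type*} [Ring A] [Algebra ℂ A] (X : σ → A) (w : FreeMonoid σ) (a : ℂ) :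
    ncEval X (MonoidAlgebra.single w a) = a • FreeMonoid.lift X w := by
  rw [ncEval, MonoidAlgebra.lift_single]

/-! ### The GNS space of a positive functional -/

/-- A positive `*`-symmetric real functional on hereditary kernels (the separating functional of
`exists_positive_functionalN`). [folklore] -/
structure PosFunctionalN (σ : Type) where
  /-- the functional -/
  L : HKer σ →ₗ[ℝ] ℝ
  /-- nonnegativity on `𝒞_free` -/
  nonneg : ∀ k ∈ coneN σ, 0 ≤ L k
  /-- vanishing on anti-Hermitian kernels -/
  anti : ∀ k, kstarK k = -k → L k = 0

namespace PosFunctionalN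

variable (Φ : PosFunctionalN σ)

/-- The complex-linear extension `Λ = L - i L(i ·)`. [folklore] -/
def Λ : HKer σ →ₗ[ℂ] ℂ := Module.Dual.extendRCLike (𝕜 := ℂ) Φ.L

/-- Formula for `Λ`. [folklore] -/
theorem Λ_apply (k : HKer σ) : Φ.Λ k = (Φ.L k : ℂ) - Complex.I * (Φ.L (Complex.I • k) : ℂ) :=
  Module.Dual.extendRCLike_apply Φ.L k

/-- `L` is `*`-invariant. [folklore] -/
theorem apply_kstarK (k : HKer σ) : Φ.L (kstarK k) = Φ.L k := by
  have h := Φ.anti (k - kstarK k) (by rw [kstarK_sub, kstarK_kstarK, neg_sub])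
  rw [map_sub, sub_eq_zero] at h
  exact h.symm

/-- `Λ(k*) = conj Λ(k)`. [folklore] -/
theorem Λ_kstarK (k : HKer σ) : Φ.Λ (kstarK k) = conj (Φ.Λ k) := by
  have h1 : Complex.I • kstarK k = -kstarK (Complex.I • k) := by
    rw [kstarK_smul, Complex.conj_I, neg_smul, neg_neg]
  rw [Λ_apply, Λ_apply, apply_kstarK, h1, map_neg, apply_kstarK, map_sub, map_mul,
    Complex.conj_ofReal, Complex.conj_ofReal, Complex.conj_I]
  push_cast
  ring

/-- On Hermitian kernels `Λ = L`. [folklore] -/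
theorem Λ_of_kstarK_eq {k : HKer σ} (hk : kstarK k = k) : Φ.Λ k = (Φ.L k : ℂ) := by
  have : Φ.L (Complex.I • k) = 0 := Φ.anti _ (by rw [kstarK_smul, hk, Complex.conj_I, neg_smul])
  rw [Λ_apply, this, Complex.ofReal_zero, mul_zero, sub_zero]

/-- **The GNS space**: a copy of `ℂ⟨g⟩` that will carry the seminorm `‖f‖² = L(|f|²)`. [folklore] -/
def Space (_Φ : PosFunctionalN σ) : Type := NC σ

/-- The additive structure of `ℂ⟨g⟩` on the GNS space. [folklore] -/
instance : AddCommGroup Φ.Space := inferInstanceAs (AddCommGroup (NC σ))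

/-- The `ℂ`-module structure of `ℂ⟨g⟩` on the GNS space. [folklore] -/
instance : Module ℂ Φ.Space := inferInstanceAs (Module ℂ (NC σ))

/-- The identity `ℂ⟨g⟩ → Space`. [folklore] -/
def toSpace : NC σ ≃ₗ[ℂ] Φ.Space := LinearEquiv.refl ℂ (NC σ)

/-- The GNS pre-inner product `⟪f, g⟫ = Λ(f* g)` (conjugate-linear in `f`). [folklore] -/
@[reducible]
def core : PreInnerProductSpace.Core ℂ Φ.Space where
  inner x y := Φ.Λ (pairK (Φ.toSpace.symm x) (Φ.toSpace.symm y))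
  conj_inner_symm x y := by
    show conj (Φ.Λ (pairK _ _)) = Φ.Λ (pairK _ _)
    rw [← Λ_kstarK, kstarK_pairK]
  re_inner_nonneg x := by
    show 0 ≤ RCLike.re (Φ.Λ (hsqN (Φ.toSpace.symm x)))
    rw [Φ.Λ_of_kstarK_eq (kstarK_hsqN _), RCLike.re_to_complex, Complex.ofReal_re]
    exact Φ.nonneg _ (hsqN_mem_coneN _)
  add_left x y z := by
    show Φ.Λ (pairK (Φ.toSpace.symm (x + y)) _) = Φ.Λ (pairK _ _) + Φ.Λ (pairK _ _)
    rw [map_add, pairK_add_left, map_add]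
  smul_left x y r := by
    show Φ.Λ (pairK (Φ.toSpace.symm (r • x)) _) = conj r * Φ.Λ (pairK _ _)
    rw [map_smul, pairK_smul_left, map_smul, smul_eq_mul]

/-- The GNS seminorm `‖f‖² = L(|f|²)` on the GNS space. [folklore] -/
instance : SeminormedAddCommGroup Φ.Space :=
  @InnerProductSpace.Core.toSeminormedAddCommGroup ℂ Φ.Space _ _ _ Φ.core

/-- The GNS (semi-)inner product space structure. [folklore] -/
instance : InnerProductSpace ℂ Φ.Space := InnerProductSpace.ofCore Φ.core

/-- **The GNS seminorm**: `‖f‖² = L(|f|²)`. [folklore] -/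
theorem norm_sq_toSpace (f : NC σ) : ‖Φ.toSpace f‖ ^ 2 = Φ.L (hsqN f) := by
  rw [@norm_sq_eq_re_inner ℂ]
  show RCLike.re (Φ.Λ (pairK (Φ.toSpace.symm (Φ.toSpace f)) (Φ.toSpace.symm (Φ.toSpace f)))) = _
  rw [LinearEquiv.symm_apply_apply, show pairK f f = hsqN f from rfl,
    Φ.Λ_of_kstarK_eq (kstarK_hsqN f), RCLike.re_to_complex, Complex.ofReal_re]

/-- Left multiplication by a letter is contractive for the GNS seminorm. [folklore] -/
theorem norm_toSpace_lmul_le (j : σ) (f : NC σ) : ‖Φ.toSpace (lmul j f)‖ ≤ ‖Φ.toSpace f‖ := by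
  have h1 := Φ.norm_sq_toSpace (lmul j f)
  have h2 := Φ.norm_sq_toSpace f
  have h3 := Φ.nonneg _ (hsqN_sub_shiftK_mem_coneN j f)
  rw [map_sub, ← hsqN_lmul] at h3
  nlinarith [norm_nonneg (Φ.toSpace (lmul j f)), norm_nonneg (Φ.toSpace f)]

/-- Left multiplication by `g_j` as a continuous linear map of the GNS space. [folklore] -/
def lmulCLM (j : σ) : Φ.Space →L[ℂ] Φ.Space :=
  LinearMap.mkContinuous
    { toFun := fun x => Φ.toSpace (lmul j (Φ.toSpace.symm x))
      map_add' := fun x y => by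
        rw [map_add, lmul, mul_add, map_add]; rfl
      map_smul' := fun a x => by
        rw [map_smul, lmul, mul_smul_comm, map_smul]; rfl }
    1 fun x => by
      rw [one_mul]
      exact Φ.norm_toSpace_lmul_le j (Φ.toSpace.symm x)

/-- `lmulCLM` on vectors. [folklore] -/
theorem lmulCLM_apply (j : σ) (f : NC σ) : Φ.lmulCLM j (Φ.toSpace f) = Φ.toSpace (lmul j f) := rfl

/-- `lmulCLM` is a contraction. [folklore] -/
theorem norm_lmulCLM_le (j : σ) : ‖Φ.lmulCLM j‖ ≤ 1 :=
  LinearMap.mkContinuous_norm_le _ zero_le_one _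

/-- **The GNS Hilbert space**: the completion of the GNS space. [folklore] -/
abbrev Hilb (Φ : PosFunctionalN σ) : Type := UniformSpace.Completion Φ.Space

/-- The vector `[f]` of an nc polynomial in the GNS Hilbert space. [folklore] -/
def vec (f : NC σ) : Φ.Hilb := ((Φ.toSpace f : Φ.Space) : UniformSpace.Completion Φ.Space)

/-- `‖[f]‖² = L(|f|²)`. [folklore] -/
theorem norm_vec_sq (f : NC σ) : ‖Φ.vec f‖ ^ 2 = Φ.L (hsqN f) := by
  rw [vec, UniformSpace.Completion.norm_coe, norm_sq_toSpace]

/-- `vec` is additive. [folklore] -/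
theorem vec_add (f g : NC σ) : Φ.vec (f + g) = Φ.vec f + Φ.vec g := by
  rw [vec, map_add, UniformSpace.Completion.coe_add]; rfl

/-- `vec` is linear. [folklore] -/
theorem vec_smul (a : ℂ) (f : NC σ) : Φ.vec (a • f) = a • Φ.vec f := by
  rw [vec, map_smul, UniformSpace.Completion.coe_smul]; rfl

/-- **The GNS operators**: the left multiplications by the letters, extended to the completion;
a tuple of contractions (NOT assumed to commute). [folklore] -/
def T (j : σ) : Φ.Hilb →L[ℂ] Φ.Hilb := (Φ.lmulCLM j).completion

/-- `T_j [f] = [g_j f]`. [folklore] -/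
theorem T_vec (j : σ) (f : NC σ) : Φ.T j (Φ.vec f) = Φ.vec (lmul j f) := by
  rw [T, vec, ContinuousLinearMap.completion_apply_coe, lmulCLM_apply]; rfl

/-- The GNS operators are contractions. [folklore] -/
theorem norm_T_le (j : σ) : ‖Φ.T j‖ ≤ 1 := by
  refine ContinuousLinearMap.opNorm_le_bound _ zero_le_one fun x => ?_
  rw [one_mul]
  induction x using UniformSpace.Completion.induction_on with
  | hp => exact isClosed_le (by fun_prop) continuous_norm
  | ih a =>
    rw [T, ContinuousLinearMap.completion_apply_coe, UniformSpace.Completion.norm_coe,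
      UniformSpace.Completion.norm_coe]
    exact (ContinuousLinearMap.le_opNorm _ _).trans
      (mul_le_of_le_one_left (norm_nonneg _) (Φ.norm_lmulCLM_le j))

/-- `F(T)[f] = [F f]`: the GNS operators realise left multiplication. [folklore] -/
theorem ncEval_T_vec (F f : NC σ) : ncEval Φ.T F (Φ.vec f) = Φ.vec (F * f) := by
  induction F using MonoidAlgebra.induction_on with
  | hM w =>
    rw [MonoidAlgebra.of_apply, ncEval_single, one_smul]
    induction w using FreeMonoid.inductionOn' generalizing f with
    | one =>
      rw [map_one]
      show Φ.vec f = _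
      rw [← MonoidAlgebra.one_def, one_mul]
    | mul_of x xs ih =>
      rw [map_mul, FreeMonoid.lift_eval_of]
      show Φ.T x (FreeMonoid.lift Φ.T xs (Φ.vec f)) = _
      rw [ih, T_vec, lmul, letter, ← mul_assoc, MonoidAlgebra.single_mul_single, one_mul]
  | hadd F G hF hG =>
    rw [map_add]
    show ncEval Φ.T F (Φ.vec f) + ncEval Φ.T G (Φ.vec f) = _
    rw [hF, hG, add_mul, vec_add]
  | hsmul r F hF =>
    rw [map_smul]
    show r • ncEval Φ.T F (Φ.vec f) = _
    rw [hF, smul_mul_assoc, vec_smul]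

/-- **Key estimate (free version).** If `Q P̂ + E = 1` with `‖Q(T)‖ ≤ C` and `‖E(T)‖ ≤ 1/2` for
the GNS operators `T`, then `L(1) ≤ (2C)² L(|P̂|²)`. [folklore] -/
theorem apply_unitK_le (P Q E : NC σ) (hQE : Q * P + E = 1) {C : ℝ}
    (hQ : ‖ncEval Φ.T Q‖ ≤ C) (hE : ‖ncEval Φ.T E‖ ≤ 1 / 2) :
    Φ.L (unitK σ) ≤ (2 * C) ^ 2 * Φ.L (hsqN P) := by
  have h1 : Φ.vec 1 = ncEval Φ.T Q (Φ.vec P) + ncEval Φ.T E (Φ.vec 1) := by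
    rw [ncEval_T_vec, ncEval_T_vec, mul_one, ← vec_add, hQE]
  have h2 : ‖Φ.vec 1‖ ≤ C * ‖Φ.vec P‖ + (1 / 2) * ‖Φ.vec 1‖ := by
    calc ‖Φ.vec 1‖ = ‖ncEval Φ.T Q (Φ.vec P) + ncEval Φ.T E (Φ.vec 1)‖ := by rw [← h1]
      _ ≤ ‖ncEval Φ.T Q (Φ.vec P)‖ + ‖ncEval Φ.T E (Φ.vec 1)‖ := norm_add_le _ _
      _ ≤ ‖ncEval Φ.T Q‖ * ‖Φ.vec P‖ + ‖ncEval Φ.T E‖ * ‖Φ.vec 1‖ :=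
        add_le_add (ContinuousLinearMap.le_opNorm _ _) (ContinuousLinearMap.le_opNorm _ _)
      _ ≤ C * ‖Φ.vec P‖ + (1 / 2) * ‖Φ.vec 1‖ :=
        add_le_add (mul_le_mul_of_nonneg_right hQ (norm_nonneg _))
          (mul_le_mul_of_nonneg_right hE (norm_nonneg _))
  have h3 : ‖Φ.vec 1‖ ≤ (2 * C) * ‖Φ.vec P‖ := by linarith
  have h4 : ‖Φ.vec 1‖ ^ 2 ≤ ((2 * C) * ‖Φ.vec P‖) ^ 2 := pow_le_pow_left₀ (norm_nonneg _) h3 2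
  rw [mul_pow, norm_vec_sq, norm_vec_sq] at h4
  rwa [MonoidAlgebra.one_def, hsqN_single_one] at h4

end PosFunctionalN

/-- **Free hereditary Positivstellensatz for `|P̂|² - c²` on the nc polydisc.** Let `P̂ ∈ ℂ⟨g⟩` admit,
for every `ε > 0`, nc polynomials `Q, E` with `Q P̂ + E = 1` whose evaluations at every tuple of
Hilbert-space contractions satisfy `‖Q(X)‖ ≤ C`, `‖E(X)‖ ≤ ε` (a quantitative form of "`P̂(X)` is
uniformly bounded below on the closed nc polydisc"). Then for `0 < c` with `2Cc < 1`,
`P̂*P̂ - c² = Σᵢ ŝᵢ*ŝᵢ + Σ_j Σᵢ t̂ᵢ*(1 - g_j*g_j)t̂ᵢ` with nc polynomials `ŝ, t̂`, i.e. `|P̂|² - c²·1 ∈ 𝒞_free`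
(cone separation + GNS, with NON-commuting left multiplications; cf. Helton–McCullough's nc
Positivstellensatz and [GrinshpanEtAl2016, Thm. 2.3] in the commutative case). [folklore] -/
theorem hsqN_sub_smul_unitK_mem_coneN (P : NC σ) {C : ℝ} (hC : 0 ≤ C)
    (huniv : ∀ ε : ℝ, 0 < ε → ∃ Q E : NC σ, Q * P + E = 1 ∧
      ∀ (H : Type) [NormedAddCommGroup H] [InnerProductSpace ℂ H] [CompleteSpace H]
        (X : σ → H →L[ℂ] H), (∀ j, ‖X j‖ ≤ 1) →
          ‖ncEval X Q‖ ≤ C ∧ ‖ncEval X E‖ ≤ ε)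
    {c : ℝ} (hc : 0 < c) (hcC : 2 * C * c < 1) :
    hsqN P - (c ^ 2) • unitK σ ∈ coneN σ := by
  by_contra hnot
  have hherm : kstarK (hsqN P - (c ^ 2) • unitK σ) = hsqN P - (c ^ 2) • unitK σ := by
    rw [kstarK_sub, kstarK_hsqN, kstarK_real_smul, kstarK_unitK]
  obtain ⟨L, hpos, hone, hle, hanti⟩ := exists_positive_functionalN hherm hnot
  let Φ : PosFunctionalN σ := ⟨L, hpos, hanti⟩
  obtain ⟨Q, E, hQE, hb⟩ := huniv (1 / 2) (by norm_num)
  obtain ⟨hQ, hE⟩ := hb Φ.Hilb Φ.T Φ.norm_T_le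
  have key := Φ.apply_unitK_le P Q E hQE hQ hE
  change L (unitK σ) ≤ (2 * C) ^ 2 * L (hsqN P) at key
  rw [map_sub, map_smul, hone, smul_eq_mul, mul_one] at hle
  rw [hone] at key
  have h3 : (2 * C) ^ 2 * L (hsqN P) ≤ (2 * C) ^ 2 * c ^ 2 :=
    mul_le_mul_of_nonneg_left (by linarith) (sq_nonneg _)
  have h4 : (2 * C) ^ 2 * c ^ 2 = (2 * C * c) ^ 2 := by ring
  have h5 : (2 * C * c) ^ 2 < 1 := by
    have : 0 ≤ 2 * C * c := by positivity
    nlinarith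
  linarith

/-! ### Unpacking a free certificate -/

/-- Square roots of the weights can be absorbed: `t |q|² = |√t q|²`. [folklore] -/
theorem nnreal_smul_hsqN (t : {c : ℝ // 0 ≤ c}) (q : NC σ) :
    (t • hsqN q : HKer σ) = hsqN (((Real.sqrt t : ℝ) : ℂ) • q) := by
  rw [hsqN_smul, Complex.normSq_ofReal, Real.mul_self_sqrt t.2, ← Nonneg.coe_smul, ofReal_smulK]

/-- **Explicit form of a free certificate.** An element of `𝒞_free` is
`Σ_{i ∈ I₀} |ŝ i|² + Σ_{n ∈ I₁} (|t̂ n|² - |g_{j n} t̂ n|²)` for finite index types. [folklore] -/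
theorem exists_sum_hsqN_of_mem_coneN {k : HKer σ} (hk : k ∈ coneN σ) :
    ∃ (I₀ I₁ : Type) (_ : Fintype I₀) (_ : Fintype I₁) (s : I₀ → NC σ) (jj : I₁ → σ)
      (t : I₁ → NC σ), k = ∑ i, hsqN (s i) + ∑ n, (hsqN (t n) - hsqN (lmul (jj n) (t n))) := by
  classical
  obtain ⟨n, τ, g, rfl⟩ := Submodule.mem_span_set'.mp hk
  let isSq : Fin n → Prop := fun i => ∃ q : NC σ, (g i : HKer σ) = hsqN q
  have hrest : ∀ i, ¬isSq i → ∃ (j : σ) (q : NC σ), (g i : HKer σ) = hsqN q - shiftK j (hsqN q) := by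
    intro i hi
    rcases (g i).2 with ⟨q, hq⟩ | ⟨j, q, hq⟩
    · exact absurd ⟨q, hq⟩ hi
    · exact ⟨j, q, hq⟩
  choose q₀ hq₀ using fun i : {i // isSq i} => i.2
  choose jj q₁ hq₁ using fun i : {i // ¬isSq i} => hrest i.1 i.2
  refine ⟨{i // isSq i}, {i // ¬isSq i}, inferInstance, inferInstance,
    fun i => ((Real.sqrt (τ i.1) : ℝ) : ℂ) • q₀ i, jj, fun i => ((Real.sqrt (τ i.1) : ℝ) : ℂ) • q₁ i, ?_⟩
  rw [← Fintype.sum_subtype_add_sum_subtype isSq (fun i => τ i • (g i : HKer σ))]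
  congr 1
  · refine Fintype.sum_congr _ _ fun i => ?_
    rw [hq₀ i, nnreal_smul_hsqN]
  · refine Fintype.sum_congr _ _ fun i => ?_
    rw [hq₁ i, smul_sub, hsqN_lmul, ← nnreal_smul_hsqN, ← Nonneg.coe_smul, ← Nonneg.coe_smul,
      ← ofReal_smulK, ← ofReal_smulK, shiftK_smul]

/-! ### The free lurking contraction -/

/-- Word-indexed coefficient vectors of a family of nc polynomials. [folklore] -/
def wcoeffVec {ι : Type} (v : ι → NC σ) (w : FreeMonoid σ) : EuclideanSpace ℂ ι :=
  WithLp.toLp 2 fun i => (v i).coeff w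

/-- Entries of `wcoeffVec`. [folklore] -/
@[simp] theorem wcoeffVec_apply {ι : Type} (v : ι → NC σ) (w : FreeMonoid σ) (i : ι) :
    wcoeffVec v w i = (v i).coeff w := rfl

/-- Gram data of the word-coefficient vectors are the entries of `Σᵢ |vᵢ|²`. [folklore] -/
theorem inner_wcoeffVec {ι : Type} [Fintype ι] (v : ι → NC σ) (w u : FreeMonoid σ) :
    inner ℂ (wcoeffVec v w) (wcoeffVec v u) = (∑ i, hsqN (v i)) (w, u) := by
  rw [Finsupp.finsetSum_apply, PiLp.inner_apply]
  refine Finset.sum_congr rfl fun i _ => ?_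
  rw [hsqN_apply, wcoeffVec_apply, wcoeffVec_apply, RCLike.inner_apply, mul_comm]

/-- **Free lurking contraction**: an identity `Σᵢ |v̂ᵢ|² = Σ_k |x̂_k|²` of hereditary kernels of nc
polynomials is realised by a contraction between the coefficient spaces,
`x̂_k = Σᵢ S_{ki} v̂ᵢ` — with no commutativity anywhere. [folklore] -/
theorem lurking_contractionN {ι κ : Type} [Fintype ι] [Fintype κ] [DecidableEq ι]
    (v : ι → NC σ) (x : κ → NC σ) (h : ∑ i, hsqN (v i) = ∑ k, hsqN (x k)) :
    ∃ S : EuclideanSpace ℂ ι →L[ℂ] EuclideanSpace ℂ κ, ‖S‖ ≤ 1 ∧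
      ∀ k, x k = ∑ i, (S (EuclideanSpace.single i 1) k) • v i := by
  classical
  set U : Finset (FreeMonoid σ) :=
    (Finset.univ.biUnion fun i => (v i).coeff.support) ∪
      Finset.univ.biUnion fun k => (x k).coeff.support with hU
  obtain ⟨S, hS, hSv⟩ := exists_contraction_of_gram_eq (A := U)
    (fun w => wcoeffVec v w) (fun w => wcoeffVec x w) (fun a b => by
      rw [inner_wcoeffVec, inner_wcoeffVec, h])
  refine ⟨S, hS, fun k => ?_⟩
  have hall : ∀ w, S (wcoeffVec v w) = wcoeffVec x w := by
    intro w
    by_cases hw : w ∈ U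
    · exact hSv ⟨w, hw⟩
    · have hv0 : wcoeffVec v w = 0 := by
        ext i
        rw [wcoeffVec_apply, WithLp.ofLp_zero, Pi.zero_apply]
        by_contra hne
        exact hw (Finset.mem_union_left _ (Finset.mem_biUnion.mpr
          ⟨i, Finset.mem_univ _, Finsupp.mem_support_iff.mpr hne⟩))
      have hx0 : wcoeffVec x w = 0 := by
        ext k'
        rw [wcoeffVec_apply, WithLp.ofLp_zero, Pi.zero_apply]
        by_contra hne
        exact hw (Finset.mem_union_right _ (Finset.mem_biUnion.mpr
          ⟨k', Finset.mem_univ _, Finsupp.mem_support_iff.mpr hne⟩))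
      rw [hv0, hx0, map_zero]
  apply MonoidAlgebra.ext
  ext w
  have := congrArg (fun u : EuclideanSpace ℂ κ => u k) (hall w)
  simp only [wcoeffVec_apply] at this
  rw [← this, clm_apply_eq_sum, MonoidAlgebra.coeff_sum]
  simp only [MonoidAlgebra.coeff_smul, Finsupp.coe_finsetSum, Finset.sum_apply,
    Finsupp.smul_apply, smul_eq_mul, wcoeffVec_apply]
  exact Finset.sum_congr rfl fun i _ => mul_comm _ _

end GKVVW
end Literature.Analysis.OperatorTheory
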